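import Summits.AtomisticToContinuum.Crystallization.Theorems.PalmUnimodularRigidityShellsToBarlowChartTransportOpsDefs

/-!
# Line `develop-the-model-growth-descent` (crux `ShellsToBarlowChart`, stmt-AtomisticToContinuum-9227): pattern facts, part 4

Decidable facts about the two integer kissing patterns `fcc3Int`, `hcpInt` (labels at squared
norm `18`) used by the frame transports of `stub_transportSystem`: hexagons, even/odd caps,
their filters, apexes, distance tables, lower caps and the letters read on them.  Every fact was
first verified by brute force (work/sim/facts.py of the lead's folder) and is proved here by
`decide` (split into small files so that each elaborates quickly).  All `[folklore]`
(finite checks on the cuboctahedron / anticuboctahedron, HalesDSP2012 §1.3).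
-/

namespace Summit.AtomisticToContinuum.Crystallization.Theorems.PalmUnimodularRigidityShellsToBarlowChart

open Literature.Geometry.DiscreteGeometry

/-- HCP: a label touching both members of a mirror pair (`D = 48`) is equatorial. [folklore] -/
theorem neg_mem_of_mirror_pair : ∀ w ∈ hcpInt, ∀ m ∈ hcpInt, ∀ l ∈ hcpInt, sqNormInt (w - m) = 18 → sqNormInt (w - l) = 18 → sqNormInt (m - l) = 48 → -w ∈ hcpInt := by
  decide

/-- No two labels touching a non-symmetric (polar) label, or any label of FCC, are a mirror pair. [folklore] -/
theorem no_48_around_polar : ∀ P : Finset (Fin 3 → ℤ), (P = fcc3Int ∨ P = hcpInt) →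
    ∀ c ∈ P, ∀ p ∈ P, ∀ q ∈ P, ((-c ∉ P) ∨ (∀ z ∈ P, -z ∈ P)) → sqNormInt (c - p) = 18 → sqNormInt (c - q) = 18 → sqNormInt (p - q) ≠ 48 := by
  rintro P (rfl | rfl) <;> decide

/-- HCP: the even cap of a frame consists of polar labels. [folklore] -/
theorem cap_not_symm_hcp_even : ∀ a ∈ hcpInt, ∀ b ∈ hcpInt, ∀ c ∈ hcpInt, sqNormInt (a - b) = 18 → hexLabels a b ⊆ hcpInt → c ∉ hexLabels a b → c - a ∈ hcpInt → c - b ∈ hcpInt → -c ∉ hcpInt ∧ -(c - a) ∉ hcpInt ∧ -(c - b) ∉ hcpInt := by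
  decide

/-- HCP: the odd cap of a frame consists of polar labels. [folklore] -/
theorem cap_not_symm_hcp_odd : ∀ a ∈ hcpInt, ∀ b ∈ hcpInt, ∀ c ∈ hcpInt, sqNormInt (a - b) = 18 → hexLabels a b ⊆ hcpInt → c ∉ hexLabels a b → c + a ∈ hcpInt → c + b ∈ hcpInt → -c ∉ hcpInt ∧ -(c + a) ∉ hcpInt ∧ -(c + b) ∉ hcpInt := by
  decide

/-- HCP even frame: the lower cap is the mirror even cap `{d, d − a, d − b}` with `D(c, d) = 48` (the set equation is stated last: instance synthesis for `decide` fails otherwise). [folklore] -/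
theorem lowerCap_evenCap_hcp : ∀ a ∈ hcpInt, ∀ b ∈ hcpInt, ∀ c ∈ hcpInt, sqNormInt (a - b) = 18 → hexLabels a b ⊆ hcpInt → c ∉ hexLabels a b → c - a ∈ hcpInt → c - b ∈ hcpInt → ∃ d ∈ lowerCap hcpInt a b ({c, c - a, c - b} : Finset (Fin 3 → ℤ)), sqNormInt (c - d) = 48 ∧ d - a ∈ hcpInt ∧ d - b ∈ hcpInt ∧ d ∉ hexLabels a b ∧ lowerCap hcpInt a b ({c, c - a, c - b} : Finset (Fin 3 → ℤ)) = ({d, d - a, d - b} : Finset (Fin 3 → ℤ)) := by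
  decide

/-- HCP odd frame: the lower cap is the mirror odd cap `{d, d + a, d + b}` with `D(c, d) = 48`. [folklore] -/
theorem lowerCap_oddCap_hcp : ∀ a ∈ hcpInt, ∀ b ∈ hcpInt, ∀ c ∈ hcpInt, sqNormInt (a - b) = 18 → hexLabels a b ⊆ hcpInt → c ∉ hexLabels a b → c + a ∈ hcpInt → c + b ∈ hcpInt → ∃ d ∈ lowerCap hcpInt a b ({c, c + a, c + b} : Finset (Fin 3 → ℤ)), sqNormInt (c - d) = 48 ∧ d + a ∈ hcpInt ∧ d + b ∈ hcpInt ∧ d ∉ hexLabels a b ∧ lowerCap hcpInt a b ({c, c + a, c + b} : Finset (Fin 3 → ℤ)) = ({d, d + a, d + b} : Finset (Fin 3 → ℤ)) := by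
  decide

/-- FCC even frame: the lower cap is the odd cap `{−c, −c + a, −c + b}`. [folklore] -/
theorem lowerCap_evenCap_fcc3Int : ∀ a ∈ fcc3Int, ∀ b ∈ fcc3Int, ∀ c ∈ fcc3Int, sqNormInt (a - b) = 18 → hexLabels a b ⊆ fcc3Int → c ∉ hexLabels a b → c - a ∈ fcc3Int → c - b ∈ fcc3Int → lowerCap fcc3Int a b ({c, c - a, c - b} : Finset (Fin 3 → ℤ)) = ({-c, -c + a, -c + b} : Finset (Fin 3 → ℤ)) := by
  decide

/-- FCC odd frame: the lower cap is the even cap `{−c, −c − a, −c − b}`. [folklore] -/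
theorem lowerCap_oddCap_fcc3Int : ∀ a ∈ fcc3Int, ∀ b ∈ fcc3Int, ∀ c ∈ fcc3Int, sqNormInt (a - b) = 18 → hexLabels a b ⊆ fcc3Int → c ∉ hexLabels a b → c + a ∈ fcc3Int → c + b ∈ fcc3Int → lowerCap fcc3Int a b ({c, c + a, c + b} : Finset (Fin 3 → ℤ)) = ({-c, -c - a, -c - b} : Finset (Fin 3 → ℤ)) := by
  decide

/-- Lower references of the four in-layer transports (evenCap): the unique lower-cap element touching `a` (resp. `b`, `−a`, `−b`), never equal or adjacent to the upper-cap element touching the same label. [folklore] -/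
theorem lowerRef_evenCap : ∀ P : Finset (Fin 3 → ℤ), (P = fcc3Int ∨ P = hcpInt) →
    ∀ a ∈ P, ∀ b ∈ P, ∀ c ∈ P, sqNormInt (a - b) = 18 → hexLabels a b ⊆ P → c ∉ hexLabels a b → c - a ∈ P → c - b ∈ P → (∃ ℓ ∈ lowerCap P a b ({c, c - a, c - b} : Finset (Fin 3 → ℤ)), sqNormInt (ℓ - a) = 18 ∧ (lowerCap P a b ({c, c - a, c - b} : Finset (Fin 3 → ℤ))).filter (fun e => sqNormInt (e - a) = 18) = {ℓ} ∧ ∀ e ∈ ({c, c - a, c - b} : Finset (Fin 3 → ℤ)), sqNormInt (e - a) = 18 → (sqNormInt (ℓ - e) ≠ 0 ∧ sqNormInt (ℓ - e) ≠ 18)) ∧ (∃ ℓ ∈ lowerCap P a b ({c, c - a, c - b} : Finset (Fin 3 → ℤ)), sqNormInt (ℓ - b) = 18 ∧ (lowerCap P a b ({c, c - a, c - b} : Finset (Fin 3 → ℤ))).filter (fun e => sqNormInt (e - b) = 18) = {ℓ} ∧ ∀ e ∈ ({c, c - a, c - b} : Finset (Fin 3 → ℤ)), sqNormInt (e - b)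 = 18 → (sqNormInt (ℓ - e) ≠ 0 ∧ sqNormInt (ℓ - e) ≠ 18)) ∧ (∃ ℓ ∈ lowerCap P a b ({c, c - a, c - b} : Finset (Fin 3 → ℤ)), sqNormInt (ℓ + a) = 18 ∧ (lowerCap P a b ({c, c - a, c - b} : Finset (Fin 3 → ℤ))).filter (fun e => sqNormInt (e + a) = 18) = {ℓ} ∧ ∀ e ∈ ({c, c - a, c - b} : Finset (Fin 3 → ℤ)), sqNormInt (e + a) = 18 → (sqNormInt (ℓ - e) ≠ 0 ∧ sqNormInt (ℓ - e) ≠ 18)) ∧ (∃ ℓ ∈ lowerCap P a b ({c, c - a, c - b} : Finset (Fin 3 → ℤ)), sqNormInt (ℓ + b) = 18 ∧ (lowerCap P a b ({c, c - a, c - b} : Finset (Fin 3 → ℤ))).filter (fun e => sqNormInt (e + b) = 18) = {ℓ} ∧ ∀ e ∈ ({c, c - a, c - b} : Finset (Fin 3 → ℤ)), sqNormInt (e + b) = 18 → (sqNormInt (ℓ - e) ≠ 0 ∧ sqNormInt (ℓ - e) ≠ 18)) := by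
  rintro P (rfl | rfl) <;> decide

/-- The cap opposite to any lower-cap label is the upper cap. [folklore] -/
theorem capOpp_of_mem_lowerCap_evenCap : ∀ P : Finset (Fin 3 → ℤ), (P = fcc3Int ∨ P = hcpInt) →
    ∀ a ∈ P, ∀ b ∈ P, ∀ c ∈ P, ∀ e ∈ P, sqNormInt (a - b) = 18 → hexLabels a b ⊆ P → c ∉ hexLabels a b → c - a ∈ P → c - b ∈ P → e ∈ lowerCap P a b ({c, c - a, c - b} : Finset (Fin 3 → ℤ)) → capOpp P a b e = ({c, c - a, c - b} : Finset (Fin 3 → ℤ)) := by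
  rintro P (rfl | rfl) <;> decide

/-- Upper-cap and lower-cap labels are never equal or adjacent. [folklore] -/
theorem cross_cap_evenCap : ∀ P : Finset (Fin 3 → ℤ), (P = fcc3Int ∨ P = hcpInt) →
    ∀ a ∈ P, ∀ b ∈ P, ∀ c ∈ P, ∀ l ∈ P, sqNormInt (a - b) = 18 → hexLabels a b ⊆ P → c ∉ hexLabels a b → c - a ∈ P → c - b ∈ P → l ∈ lowerCap P a b ({c, c - a, c - b} : Finset (Fin 3 → ℤ)) → (sqNormInt (c - l) ≠ 0 ∧ sqNormInt (c - l) ≠ 18) ∧ (sqNormInt (c - a - l) ≠ 0 ∧ sqNormInt (c - a - l) ≠ 18) ∧ (sqNormInt (c - b - l) ≠ 0 ∧ sqNormInt (c - b - l) ≠ 18) := by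
  rintro P (rfl | rfl) <;> decide

end Summit.AtomisticToContinuum.Crystallization.Theorems.PalmUnimodularRigidityShellsToBarlowChart
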